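import Summits.QuantumFields.QCD.Theorems.HeatSlicedQuarksWilsonLichnerowiczDirac
import Literature.MathematicalPhysics.QuantumLattice.LatticeToriProofs
import Literature.MathematicalPhysics.QuantumLattice.TorusTestPotential

/-!
# Wilson–Lichnerowicz bound (stmt-QuantumFields-8874): the four commutator shapes

For the link commutators `[T_i,T_j]`, `[T_i,T_j†]`, `[T_i†,T_j]`, `[T_i†,T_j†]` the commutator
field `A_x B_x⁻¹` is conjugate to the plaquette holonomy based at `x`, `x - ĵ`, `x - î`,
`x - î - ĵ` respectively (`re_trace_FF/FB/BF/BB`), whence `‖⟨w, [X,Y]v⟩‖ ≤ 3√2 · phi U v` for any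
`w` whose site norms are a unit translate of those of `v` (`norm_ip_FF/FB/BF/BB_le`), and the
three cross-term lower bounds `Re⟨K_μv,K_νv⟩ ≥ -12√2 Φ`, `Re⟨K_μv,γ_νa_νv⟩ ≥ -6√2 Φ`,
`Re⟨γ_μa_μv,γ_νa_νv⟩ ≥ -6√2 Φ` (`μ ≠ ν`).
-/

noncomputable section

namespace Summit.QuantumFields.QCD.Theorems.WilsonLichnerowicz

open Literature.Probability.LatticeModels Matrix
open scoped ComplexConjugate

variable {L : ℕ}

/-! ## The four commutator shapes and their plaquettes -/

section Shapes

open Literature.MathematicalPhysics.QuantumLattice Literature.MathematicalPhysics.QuantumFieldTheory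


/-- Plaquette of the shape `[T_i, T_j]`: based at `x`. -/
theorem re_trace_FF (U : GaugeConfig 4 L SU3) (i j : Fin 4) (x : TorusSite 4 L) :
    (((U (x, i) * U (x + Pi.single i 1, j) * (U (x, j) * U (x + Pi.single j 1, i))⁻¹ : SU3)) :
        Matrix (Fin 3) (Fin 3) ℂ).trace.re =
      (((plaquetteHolonomy U (x + 0) i j : SU3)) : Matrix (Fin 3) (Fin 3) ℂ).trace.re := by
  simp only [plaquetteHolonomy, Literature.MathematicalPhysics.QuantumFieldTheory.Site.shift,
    _root_.mul_inv_rev, mul_assoc, add_zero]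

/-- Plaquette of the shape `[T_i, T_j†]`: based at `x - ĵ`, orientation `(j, i)`. -/
theorem re_trace_FB (U : GaugeConfig 4 L SU3) (i j : Fin 4) (x : TorusSite 4 L) :
    (((U (x, i) * (U (x + Pi.single i 1 - Pi.single j 1, j))⁻¹ *
        ((U (x - Pi.single j 1, j))⁻¹ * U (x + -Pi.single j 1, i))⁻¹ : SU3)) :
        Matrix (Fin 3) (Fin 3) ℂ).trace.re =
      (((plaquetteHolonomy U (x + -Pi.single j 1) j i : SU3)) : Matrix (Fin 3) (Fin 3) ℂ).trace.re := by
  have h1 : x + Pi.single i 1 - Pi.single j 1 = x + -Pi.single j 1 + Pi.single i 1 := by abel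
  have h2 : x - Pi.single j 1 = x + -Pi.single j 1 := by abel
  rw [h1, h2]
  set y := x + -Pi.single j 1 with hy
  have h3 : x = y + Pi.single j 1 := by rw [hy]; abel
  rw [h3, ← trace_conj (U (y, j))⁻¹ (plaquetteHolonomy U y j i)]
  congr 3
  simp only [plaquetteHolonomy, Literature.MathematicalPhysics.QuantumFieldTheory.Site.shift,
    _root_.mul_inv_rev, inv_inv, mul_assoc, inv_mul_cancel_left]

/-- Plaquette of the shape `[T_i†, T_j]`: based at `x - î`, orientation `(j, i)`. -/
theorem re_trace_BF (U : GaugeConfig 4 L SU3) (i j : Fin 4) (x : TorusSite 4 L) :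
    ((((U (x - Pi.single i 1, i))⁻¹ * U (x + -Pi.single i 1, j) *
        (U (x, j) * (U (x + Pi.single j 1 - Pi.single i 1, i))⁻¹)⁻¹ : SU3)) :
        Matrix (Fin 3) (Fin 3) ℂ).trace.re =
      (((plaquetteHolonomy U (x + -Pi.single i 1) j i : SU3)) : Matrix (Fin 3) (Fin 3) ℂ).trace.re := by
  have h1 : x + Pi.single j 1 - Pi.single i 1 = x + -Pi.single i 1 + Pi.single j 1 := by abel
  have h2 : x - Pi.single i 1 = x + -Pi.single i 1 := by abel
  rw [h1, h2]
  set y := x + -Pi.single i 1 with hy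
  have h3 : x = y + Pi.single i 1 := by rw [hy]; abel
  rw [h3, ← trace_conj (U (y, i))⁻¹ (plaquetteHolonomy U y j i)]
  congr 3
  simp only [plaquetteHolonomy, Literature.MathematicalPhysics.QuantumFieldTheory.Site.shift,
    _root_.mul_inv_rev, inv_inv, mul_assoc, inv_mul_cancel, mul_one]

/-- Plaquette of the shape `[T_i†, T_j†]`: based at `x - î - ĵ`, orientation `(i, j)`. -/
theorem re_trace_BB (U : GaugeConfig 4 L SU3) (i j : Fin 4) (x : TorusSite 4 L) :
    ((((U (x - Pi.single i 1, i))⁻¹ * (U (x + -Pi.single i 1 - Pi.single j 1, j))⁻¹ *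
        ((U (x - Pi.single j 1, j))⁻¹ * (U (x + -Pi.single j 1 - Pi.single i 1, i))⁻¹)⁻¹ : SU3)) :
        Matrix (Fin 3) (Fin 3) ℂ).trace.re =
      (((plaquetteHolonomy U (x + (-Pi.single i 1 + -Pi.single j 1)) i j : SU3)) :
        Matrix (Fin 3) (Fin 3) ℂ).trace.re := by
  set z := x + (-Pi.single i 1 + -Pi.single j 1) with hz
  have h1 : x - Pi.single i 1 = z + Pi.single j 1 := by rw [hz]; abel
  have h2 : x + -Pi.single i 1 - Pi.single j 1 = z := by rw [hz]; abel
  have h3 : x - Pi.single j 1 = z + Pi.single i 1 := by rw [hz]; abel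
  have h4 : x + -Pi.single j 1 - Pi.single i 1 = z := by rw [hz]; abel
  rw [h1, h2, h3, h4, ← trace_conj ((U (z + Pi.single j 1, i))⁻¹ * (U (z, j))⁻¹) (plaquetteHolonomy U z i j)]
  congr 3
  simp only [plaquetteHolonomy, Literature.MathematicalPhysics.QuantumFieldTheory.Site.shift,
    _root_.mul_inv_rev, inv_inv, mul_assoc, inv_mul_cancel_left, inv_mul_cancel, mul_one]

variable [NeZero L]

/-- A unit lattice vector has torus norm at most `1`. -/
theorem torusNorm_single_le (i : Fin 4) : torusNorm (Pi.single i (1 : ZMod L) : TorusSite 4 L) ≤ 1 := by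
  have h := (torusNorm_add_single_le (d := 4) L (0 : TorusSite 4 L) i).1
  rwa [zero_add, torusNorm_zero, zero_add] at h

/-- Shape `[T_i, T_j]`: `‖⟨w, [T_i,T_j] v⟩‖ ≤ 3√2 Φ` for `w` a unit translate of `v` in site norm. -/
theorem norm_ip_FF_le (U : GaugeConfig 4 L SU3) (i j : Fin 4) (w v : Fld L) (t : TorusSite 4 L)
    (hw : ∀ x, siteSq w x = siteSq v (x + t)) (ht : torusNorm t ≤ 1) :
    ‖ip w (fwd U i (fwd U j v) - fwd U j (fwd U i v))‖ ≤ 3 * Real.sqrt 2 * phi U v := by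
  have hi := torusNorm_single_le (L := L) i
  have hj := torusNorm_single_le (L := L) j
  have h := norm_ip_comm_le U (fun x => U (x, i)) (fun x => U (x, j)) (Pi.single i 1)
    (Pi.single j 1) 0 t i j (fun x => by exact re_trace_FF U i j x) w v hw (by rw [sub_zero]; omega)
    (by rw [sub_zero]; exact (torusNorm_add_le _ _).trans (by omega))
  rw [fwd_eq U i, fwd_eq U j]
  exact h

/-- Shape `[T_i, T_j†]`. -/
theorem norm_ip_FB_le (U : GaugeConfig 4 L SU3) (i j : Fin 4) (w v : Fld L) (t : TorusSite 4 L)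
    (hw : ∀ x, siteSq w x = siteSq v (x + t)) (ht : torusNorm t ≤ 1) :
    ‖ip w (fwd U i (bwd U j v) - bwd U j (fwd U i v))‖ ≤ 3 * Real.sqrt 2 * phi U v := by
  have hi := torusNorm_single_le (L := L) i
  have hj := torusNorm_single_le (L := L) j
  have h := norm_ip_comm_le U (fun x => U (x, i)) (fun x => (U (x - Pi.single j 1, j))⁻¹)
    (Pi.single i 1) (-Pi.single j 1) (-Pi.single j 1) t j i (fun x => by exact re_trace_FB U i j x) w v hw
    (by rw [sub_neg_eq_add]; exact (torusNorm_add_le _ _).trans (by omega))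
    (by rw [sub_neg_eq_add, neg_add_cancel_right]; omega)
  rw [fwd_eq U i, bwd_eq U j]
  exact h

/-- Shape `[T_i†, T_j]`. -/
theorem norm_ip_BF_le (U : GaugeConfig 4 L SU3) (i j : Fin 4) (w v : Fld L) (t : TorusSite 4 L)
    (hw : ∀ x, siteSq w x = siteSq v (x + t)) (ht : torusNorm t ≤ 1) :
    ‖ip w (bwd U i (fwd U j v) - fwd U j (bwd U i v))‖ ≤ 3 * Real.sqrt 2 * phi U v := by
  have hi := torusNorm_single_le (L := L) i
  have hj := torusNorm_single_le (L := L) j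
  have h := norm_ip_comm_le U (fun x => (U (x - Pi.single i 1, i))⁻¹) (fun x => U (x, j))
    (-Pi.single i 1) (Pi.single j 1) (-Pi.single i 1) t j i (fun x => by exact re_trace_BF U i j x) w v hw
    (by rw [sub_neg_eq_add]; exact (torusNorm_add_le _ _).trans (by omega))
    (by rw [sub_neg_eq_add, neg_add_cancel_comm]; omega)
  rw [bwd_eq U i, fwd_eq U j]
  exact h

/-- Shape `[T_i†, T_j†]`. -/
theorem norm_ip_BB_le (U : GaugeConfig 4 L SU3) (i j : Fin 4) (w v : Fld L) (t : TorusSite 4 L)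
    (hw : ∀ x, siteSq w x = siteSq v (x + t)) (ht : torusNorm t ≤ 1) :
    ‖ip w (bwd U i (bwd U j v) - bwd U j (bwd U i v))‖ ≤ 3 * Real.sqrt 2 * phi U v := by
  have hi := torusNorm_single_le (L := L) i
  have hj := torusNorm_single_le (L := L) j
  have h := norm_ip_comm_le U (fun x => (U (x - Pi.single i 1, i))⁻¹)
    (fun x => (U (x - Pi.single j 1, j))⁻¹) (-Pi.single i 1) (-Pi.single j 1)
    (-Pi.single i 1 + -Pi.single j 1) t i j (fun x => by exact re_trace_BB U i j x) w v hw
    (by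
      rw [show t - (-Pi.single i 1 + -Pi.single j 1) = t + Pi.single i 1 + Pi.single j 1 by abel]
      exact (torusNorm_add_le _ _).trans
        ((Nat.add_le_add_right (torusNorm_add_le _ _) _).trans (by omega)))
    (by rw [sub_self, torusNorm_zero]; omega)
  rw [bwd_eq U i, bwd_eq U j]
  exact h

/-- `‖⟨u, w⟩‖ = ‖⟨w, u⟩‖`. -/
theorem norm_ip_comm (u w : Fld L) : ‖ip u w‖ = ‖ip w u‖ := by
  rw [← conj_ip, Complex.norm_conj]

/-- `-‖z‖ ≤ Re z`. -/
private theorem neg_norm_le_re (z : ℂ) : -‖z‖ ≤ z.re := (abs_le.mp (Complex.abs_re_le_norm z)).1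

/-- Lower bound for the Laplacian cross term: `Re⟨K_μ v, K_ν v⟩ ≥ -12√2 Φ`. -/
theorem re_ip_lapK_lapK_ge (U : GaugeConfig 4 L SU3) (μ ν : Fin 4) (v : Fld L) :
    -(12 * Real.sqrt 2 * phi U v) ≤ (ip (lapK U μ v) (lapK U ν v)).re := by
  rw [re_ip_lapK_lapK]
  have hn := nsq_nonneg ((v - fwd U ν v) - fwd U μ (v - fwd U ν v))
  have h0 : ∀ x, siteSq v x = siteSq v (x + 0) := fun x => by rw [add_zero]
  have ht0 : torusNorm (0 : TorusSite 4 L) ≤ 1 := by rw [torusNorm_zero]; omega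
  have h1 := norm_ip_FF_le U ν μ v v 0 h0 ht0
  have h2 := norm_ip_FF_le U ν μ (fwd U ν v) v (Pi.single ν 1) (siteSq_fwd U ν v)
    (torusNorm_single_le ν)
  have h3 := norm_ip_FB_le U ν μ v v 0 h0 ht0
  have h4 := norm_ip_FB_le U ν μ (fwd U ν v) v (Pi.single ν 1) (siteSq_fwd U ν v)
    (torusNorm_single_le ν)
  have hb : ‖ip (fwd U ν (fwd U μ v) - fwd U μ (fwd U ν v) +
      (fwd U ν (bwd U μ v) - bwd U μ (fwd U ν v))) (v - fwd U ν v)‖ ≤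
      12 * Real.sqrt 2 * phi U v := by
    rw [norm_ip_comm, ip_add_right, ip_sub_left, ip_sub_left]
    have e1 := norm_add_le (ip v (fwd U ν (fwd U μ v) - fwd U μ (fwd U ν v)) -
      ip (fwd U ν v) (fwd U ν (fwd U μ v) - fwd U μ (fwd U ν v)))
      (ip v (fwd U ν (bwd U μ v) - bwd U μ (fwd U ν v)) -
        ip (fwd U ν v) (fwd U ν (bwd U μ v) - bwd U μ (fwd U ν v)))
    have e2 := norm_sub_le (ip v (fwd U ν (fwd U μ v) - fwd U μ (fwd U ν v)))
      (ip (fwd U ν v) (fwd U ν (fwd U μ v) - fwd U μ (fwd U ν v)))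
    have e3 := norm_sub_le (ip v (fwd U ν (bwd U μ v) - bwd U μ (fwd U ν v)))
      (ip (fwd U ν v) (fwd U ν (bwd U μ v) - bwd U μ (fwd U ν v)))
    linarith
  have hre := neg_norm_le_re (ip (fwd U ν (fwd U μ v) - fwd U μ (fwd U ν v) +
      (fwd U ν (bwd U μ v) - bwd U μ (fwd U ν v))) (v - fwd U ν v))
  linarith

/-- `‖⟨w, -a⟩‖ = ‖⟨w, a⟩‖`. -/
theorem norm_ip_neg_right (w a : Fld L) : ‖ip w (-a)‖ = ‖ip w a‖ := by
  rw [ip_neg_right, norm_neg]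

/-- Four bounded pieces: `Re⟨w, a + b + c + d⟩ ≥ -4B`. -/
theorem re_ip_sum4_ge (w a b c d : Fld L) {B : ℝ} (ha : ‖ip w a‖ ≤ B) (hb : ‖ip w b‖ ≤ B)
    (hc : ‖ip w c‖ ≤ B) (hd : ‖ip w d‖ ≤ B) : -(4 * B) ≤ (ip w (a + b + c + d)).re := by
  rw [ip_add_right, ip_add_right, ip_add_right]
  have h := neg_norm_le_re (ip w a + ip w b + ip w c + ip w d)
  have e1 := norm_add_le (ip w a + ip w b + ip w c) (ip w d)
  have e2 := norm_add_le (ip w a + ip w b) (ip w c)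
  have e3 := norm_add_le (ip w a) (ip w b)
  linarith

/-- Lower bound for the mixed cross term: `Re⟨K_μ v, γ_ν a_ν v⟩ ≥ -6√2 Φ`. -/
theorem re_ip_lapK_spin_asym_ge (U : GaugeConfig 4 L SU3) (μ ν : Fin 4) (v : Fld L) :
    -(6 * Real.sqrt 2 * phi U v) ≤ (ip (lapK U μ v) (spin (euclideanGamma ν) (asym U ν v))).re := by
  rw [re_ip_lapK_spin_asym_two, lapK_asym_sub]
  have hw : ∀ x, siteSq (spin (euclideanGamma ν) v) x = siteSq v (x + 0) := fun x => by
    rw [add_zero]; exact siteSq_gamma ν v x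
  have ht0 : torusNorm (0 : TorusSite 4 L) ≤ 1 := by rw [torusNorm_zero]; omega
  have h1 := norm_ip_FF_le U μ ν _ v 0 hw ht0
  have h2 := norm_ip_FB_le U μ ν _ v 0 hw ht0
  have h3 := norm_ip_BF_le U μ ν _ v 0 hw ht0
  have h4 := norm_ip_BB_le U μ ν _ v 0 hw ht0
  rw [← norm_ip_neg_right] at h1 h3
  have h := re_ip_sum4_ge _ _ _ _ _ h1 h2 h3 h4
  linarith

/-- Lower bound for the Clifford cross term: `Re⟨γ_μ a_μ v, γ_ν a_ν v⟩ ≥ -6√2 Φ` for `μ ≠ ν`. -/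
theorem re_ip_spin_asym_spin_asym_ge (U : GaugeConfig 4 L SU3) {μ ν : Fin 4} (hμν : μ ≠ ν)
    (v : Fld L) :
    -(6 * Real.sqrt 2 * phi U v) ≤
      (ip (spin (euclideanGamma μ) (asym U μ v)) (spin (euclideanGamma ν) (asym U ν v))).re := by
  rw [re_ip_spin_asym_spin_asym U hμν, asym_asym_sub]
  have hw : ∀ x, siteSq (spin (euclideanGamma ν) (spin (euclideanGamma μ) v)) x = siteSq v (x + 0) :=
    fun x => by rw [add_zero, siteSq_gamma, siteSq_gamma]
  have ht0 : torusNorm (0 : TorusSite 4 L) ≤ 1 := by rw [torusNorm_zero]; omega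
  have h1 := norm_ip_FF_le U μ ν _ v 0 hw ht0
  have h2 := norm_ip_FB_le U μ ν _ v 0 hw ht0
  have h3 := norm_ip_BF_le U μ ν _ v 0 hw ht0
  have h4 := norm_ip_BB_le U μ ν _ v 0 hw ht0
  rw [← norm_ip_neg_right] at h2 h3
  have h := re_ip_sum4_ge _ _ _ _ _ h1 h2 h3 h4
  have h' := Complex.re_le_norm (ip (spin (euclideanGamma ν) (spin (euclideanGamma μ) v))
    ((fwd U μ (fwd U ν v) - fwd U ν (fwd U μ v)) + -(fwd U μ (bwd U ν v) - bwd U ν (fwd U μ v)) +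
      -(bwd U μ (fwd U ν v) - fwd U ν (bwd U μ v)) + (bwd U μ (bwd U ν v) - bwd U ν (bwd U μ v))))
  have hn : ‖ip (spin (euclideanGamma ν) (spin (euclideanGamma μ) v))
    ((fwd U μ (fwd U ν v) - fwd U ν (fwd U μ v)) + -(fwd U μ (bwd U ν v) - bwd U ν (fwd U μ v)) +
      -(bwd U μ (fwd U ν v) - fwd U ν (bwd U μ v)) + (bwd U μ (bwd U ν v) - bwd U ν (bwd U μ v)))‖ ≤
      12 * Real.sqrt 2 * phi U v := by
    rw [ip_add_right, ip_add_right, ip_add_right]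
    have e1 := norm_add_le (ip (spin (euclideanGamma ν) (spin (euclideanGamma μ) v))
        (fwd U μ (fwd U ν v) - fwd U ν (fwd U μ v)) +
      ip (spin (euclideanGamma ν) (spin (euclideanGamma μ) v))
        (-(fwd U μ (bwd U ν v) - bwd U ν (fwd U μ v))) +
      ip (spin (euclideanGamma ν) (spin (euclideanGamma μ) v))
        (-(bwd U μ (fwd U ν v) - fwd U ν (bwd U μ v))))
      (ip (spin (euclideanGamma ν) (spin (euclideanGamma μ) v))
        (bwd U μ (bwd U ν v) - bwd U ν (bwd U μ v)))
    have e2 := norm_add_le (ip (spin (euclideanGamma ν) (spin (euclideanGamma μ) v))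
        (fwd U μ (fwd U ν v) - fwd U ν (fwd U μ v)) +
      ip (spin (euclideanGamma ν) (spin (euclideanGamma μ) v))
        (-(fwd U μ (bwd U ν v) - bwd U ν (fwd U μ v))))
      (ip (spin (euclideanGamma ν) (spin (euclideanGamma μ) v))
        (-(bwd U μ (fwd U ν v) - fwd U ν (bwd U μ v))))
    have e3 := norm_add_le (ip (spin (euclideanGamma ν) (spin (euclideanGamma μ) v))
        (fwd U μ (fwd U ν v) - fwd U ν (fwd U μ v)))
      (ip (spin (euclideanGamma ν) (spin (euclideanGamma μ) v))
        (-(fwd U μ (bwd U ν v) - bwd U ν (fwd U μ v))))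
    linarith
  linarith

end Shapes


end Summit.QuantumFields.QCD.Theorems.WilsonLichnerowicz
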